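import Summits.BirchSwinnertonDyer.BirchSwinnertonDyer.Theorems.ErratumRoadFiveBigRepTorsionDefs
import Literature.NumberTheory.EllipticCurves.BigRepModuleCoeffExtension
import HarnessLib

/-!
# Crux 4 `BSDpOnCellC` (stmt-BirchSwinnertonDyer-19034), line «telescope», leaf N2 sub-leaf W3 / leaf N3′ — THE ADDITIVE IDENTIFICATION
# `(A[c]) ⊗ Λ_R^* ≃ (A ⊗ Λ_𝒪^*)[C c]` ACROSS THE TWO SCALAR RINGS, with its equivariance and semilinearity
# (successor LEAD `cruxlead-19034` g3; `--supports`, helper; THEOREMS ONLY)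

HONEST FRAMING. Generic; no curve; proves no stub, no crux, no summit statement; BSD is proved for no curve. Fourth brick of the W3 transport:
it manufactures the input `(η, hη, hησ)` of brick 3 `TelescopeK2SelmerScalarTransport.exists_selmer_addEquiv` / `nonempty_dual_linearEquiv` for
the two modules that W3 forces us to compare:

* `M₁ = BigRepModule R p (A[c])` — the big module of the `c`-torsion `A[c] = Submodule.torsionBy 𝒪 A c` with scalars RESTRICTED to a subring
  `R → 𝒪` (in W3: `R = ℤ_p`, `𝒪 = ℤ_p⟦X⟧`, `c = X`, `A = A₂` of leaf N1, so `M₁` is a `Λ = ℤ_p⟦T⟧`-module and bricks 1–2 apply to it and to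
  the `E`-side `BigRepModule ℤ_p p E[p^∞]` over the SAME ring);
* `M₂ = (BigRepModule 𝒪 p A)[C c]` — the `C c`-torsion of the big module over `Λ_𝒪 = 𝒪⟦T⟧` (in W3: `M₂[C X]`, whose Selmer dual is `Y`).

`exists_torsion_bigRep_addEquiv`: there is a continuous additive equivalence `η : M₁ ≃ₜ+ M₂` (both discrete) which (i) is the identity on the
underlying functions `ℤ_p → A`, (ii) intertwines `bigRep κ ρ₀` and the `C c`-torsion subrepresentation of `bigRep κ ρ` for ANY `R`-linear
`ρ₀` on `A[c]` agreeing with `ρ` pointwise (e.g. the scalar restriction of `torsionRep ρ c`), and (iii) is semilinear along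
`algebraMap R⟦T⟧ 𝒪⟦T⟧ = PowerSeries.map (algebraMap R 𝒪)`. It is the composite of the tree's `BigRepModule.restrictScalarsEquiv R` (lit, Skinner
2016 §2.3: same maps, scalars forgotten; `restrictScalarsEquiv_map_smul`) and bsd-stepL's `BigRep.torsionValuedEquiv` (torsion of the big module =
big module of the torsion; `coe_torsionValuedEquiv_bigRep`). Nothing new is defined.

References: C. Skinner, Pacific J. Math. 283 (2016) §2.3 (p. 179–180, Lemma 2.3.1) [Skinner2016PacificMC]; F. Castella, Camb. J. Math. 6 (2018) §2.1–2.2 and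
Erratum §2 [Castella2018] [Castella2018Erratum].
-/

noncomputable section

open PowerSeries Literature.NumberTheory.GaloisRepresentations Literature.NumberTheory.EllipticCurves
  Literature.NumberTheory.EllipticCurves.BigRepModule
  Summit.BirchSwinnertonDyer.Rank1Residual.X11b.TorsionControl
  Summit.BirchSwinnertonDyer.Rank1Residual.X11b.BigRep

universe u

set_option linter.dupNamespace false

namespace Summit.BirchSwinnertonDyer.BirchSwinnertonDyer.Theorems.TelescopeK2TorsionBigRepIdentification

variable {R : Type*} [CommRing R] {𝒪 : Type*} [CommRing 𝒪] [Algebra R 𝒪] {p : ℕ} [Fact p.Prime]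
  {A : Type u} [AddCommGroup A] [Module 𝒪 A] [Module R A] [IsScalarTower R 𝒪 A]

/-- `algebraMap R⟦T⟧ 𝒪⟦T⟧` is coefficientwise `algebraMap R 𝒪` (Mathlib's `PowerSeries.algebraPowerSeries`). [folklore] -/
theorem algebraMap_powerSeries_eq (t : PowerSeries R) :
    algebraMap (PowerSeries R) (PowerSeries 𝒪) t = PowerSeries.map (algebraMap R 𝒪) t := rfl

variable [TopologicalSpace 𝒪] [TopologicalSpace R] [TopologicalSpace A] [DiscreteTopology A]
  {Γ : Type u} [Group Γ] [TopologicalSpace Γ] [ContinuousMul Γ]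
  [TopologicalSpace (PowerSeries 𝒪)] [TopologicalSpace (PowerSeries R)]

/-- **`(A[c]) ⊗ Λ_R^* ≃ₜ+ (A ⊗ Λ_𝒪^*)[C c]`, equivariant and semilinear.** For `κ : Γ →ₜ* ℤ_p`, a discrete `ρ : ContinuousRep Γ 𝒪 A`, `c ∈ 𝒪`,
and any `R`-linear continuous representation `ρ₀` of `Γ` on `A[c]` with `ρ₀ g a = ρ g a` in `A`: a continuous additive equivalence
`η : BigRepModule R p (A[c]) ≃ₜ+ (BigRepModule 𝒪 p A)[C c]` with (i) `(η Φ)(x) = Φ(x)` in `A`; (ii) `η (bigRep κ ρ₀ g Φ) = (torsionRep (bigRep κ ρ) (C c)) g (η Φ)`;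
(iii) `η (t • Φ) = algebraMap R⟦T⟧ 𝒪⟦T⟧ t • η Φ`. These are the hypotheses `hη`, `hησ` of `TelescopeK2SelmerScalarTransport.exists_selmer_addEquiv` /
`nonempty_dual_linearEquiv`. [cite: Skinner2016PacificMC, §2.3 Lemma 2.3.1 (p. 180)] [cite: Castella2018Erratum, §2 p. 4 and Lemma 2.1] -/
theorem exists_torsion_bigRep_addEquiv (κ : Γ →ₜ* Multiplicative ℤ_[p]) (ρ : ContinuousRep Γ 𝒪 A) (c : 𝒪)
    (ρ₀ : ContinuousRep Γ R (Submodule.torsionBy 𝒪 A c))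
    (hρ₀ : ∀ (g : Γ) (a : Submodule.torsionBy 𝒪 A c), ((ρ₀ g a : Submodule.torsionBy 𝒪 A c) : A) = ρ g a) :
    ∃ η : BigRepModule R p (Submodule.torsionBy 𝒪 A c) ≃ₜ+
        Submodule.torsionBy (PowerSeries 𝒪) (BigRepModule 𝒪 p A) (PowerSeries.C c),
      (∀ (Φ : BigRepModule R p (Submodule.torsionBy 𝒪 A c)) (x : ℤ_[p]),
          (η Φ : BigRepModule 𝒪 p A) x = (Φ x : A)) ∧
      (∀ (g : Γ) (Φ : BigRepModule R p (Submodule.torsionBy 𝒪 A c)),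
          η (bigRep κ ρ₀ g Φ) = torsionRep (bigRep (p := p) κ ρ) (PowerSeries.C c) g (η Φ)) ∧
      (∀ (t : PowerSeries R) (Φ : BigRepModule R p (Submodule.torsionBy 𝒪 A c)),
          η (t • Φ) = algebraMap (PowerSeries R) (PowerSeries 𝒪) t • η Φ) := by
  -- the two tree equivalences
  let ε₁ : BigRepModule 𝒪 p (Submodule.torsionBy 𝒪 A c) ≃+ BigRepModule R p (Submodule.torsionBy 𝒪 A c) :=
    restrictScalarsEquiv R
  let ε₂ : BigRepModule 𝒪 p (Submodule.torsionBy 𝒪 A c) ≃ₗ[PowerSeries 𝒪]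
      Submodule.torsionBy (PowerSeries 𝒪) (BigRepModule 𝒪 p A) (PowerSeries.C c) :=
    torsionValuedEquiv (p := p) rfl
  let η₀ : BigRepModule R p (Submodule.torsionBy 𝒪 A c) ≃+
      Submodule.torsionBy (PowerSeries 𝒪) (BigRepModule 𝒪 p A) (PowerSeries.C c) :=
    ε₁.symm.trans ε₂.toAddEquiv
  let η : BigRepModule R p (Submodule.torsionBy 𝒪 A c) ≃ₜ+
      Submodule.torsionBy (PowerSeries 𝒪) (BigRepModule 𝒪 p A) (PowerSeries.C c) :=
    { η₀ with
      continuous_toFun := continuous_of_discreteTopology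
      continuous_invFun := continuous_of_discreteTopology }
  have hηval : ∀ (Φ : BigRepModule R p (Submodule.torsionBy 𝒪 A c)) (x : ℤ_[p]),
      (η Φ : BigRepModule 𝒪 p A) x = (Φ x : A) := fun Φ x => rfl
  refine ⟨η, hηval, fun g Φ => ?_, fun t Φ => ?_⟩
  · -- (ii) equivariance: both sides are `x ↦ ρ g (Φ (x - κ g))`
    apply Subtype.ext
    ext x
    rw [hηval]
    change ((bigRep κ ρ₀ g Φ x : Submodule.torsionBy 𝒪 A c) : A) =
      (bigRep (p := p) κ ρ g (η Φ : BigRepModule 𝒪 p A)) x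
    rw [bigRep_apply_apply, bigRep_apply_apply, hρ₀, hηval]
  · -- (iii) semilinearity along `R⟦T⟧ → 𝒪⟦T⟧`
    have h1 : ε₁.symm (t • Φ) = PowerSeries.map (algebraMap R 𝒪) t • ε₁.symm Φ := by
      apply ε₁.injective
      rw [AddEquiv.apply_symm_apply]
      change t • Φ = restrictScalarsEquiv R (PowerSeries.map (algebraMap R 𝒪) t • ε₁.symm Φ)
      rw [restrictScalarsEquiv_map_smul]
      change t • Φ = t • ε₁ (ε₁.symm Φ)
      rw [AddEquiv.apply_symm_apply]
    change ε₂ (ε₁.symm (t • Φ)) = algebraMap (PowerSeries R) (PowerSeries 𝒪) t • ε₂ (ε₁.symm Φ)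
    rw [h1, map_smul, algebraMap_powerSeries_eq]

end Summit.BirchSwinnertonDyer.BirchSwinnertonDyer.Theorems.TelescopeK2TorsionBigRepIdentification

end
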